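import Mathlib
import Summits.NavierStokesRegularity.NavierStokesRegularity.Theorems.FilamentSkeletonRssAnalyticStripLiaSymbolSeriesDefs
import Summits.NavierStokesRegularity.NavierStokesRegularity.Theorems.FilamentSkeletonRssAnalyticStripLiaSymbolSeriesExp
import Summits.NavierStokesRegularity.NavierStokesRegularity.Theorems.FilamentSkeletonRssAnalyticStripLiaSymbolSeriesFar
import Summits.NavierStokesRegularity.NavierStokesRegularity.Theorems.FilamentSkeletonRssAnalyticStripLiaSymbolSeriesNear

/-!
# Stub P3 `LiaSymbolBound` — KERNEL-ONLY numerics, brick 5a: SOUNDNESS I of the rational series checker (`…LiaSymbolSeriesDefs`)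

Hand leafhand-ns-filamentskeletonrs-7 g1 (prover), 2026-08-31, `--supports stmt-NavierStokesRegularity-23320 --as helper` (tenure P5-(B)).
Standard axioms.  Casts of the partial sums (`expT`, `einT`, `logS`) to the real `Finset` sums of bricks 1–3; the enclosures
`expLo ≤ e^{−y} ≤ expHi` (`exp_encl`), `einLo ≤ Ein ≤ einHi`, `logLo ≤ log p ≤ logHi` (node `p = 2^k r`, `|1−r| ≤ 1/2`, Mathlib's `log 2` decimals and
`Real.abs_log_sub_add_sum_range_le`), `a0Lo ≤ α₀(p) ≤ a0Hi` (brick 3 `alpha_zero`, brick 1 `γ`-bounds), and the moment enclosures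
`alphaB` (brick 3 `alpha_succ`) and `betaB` (brick 2 `beta_zero/one/succ`).  Part II (`…SeriesWindow`): the alternating sums, `E`/`C`, the cells,
the kernel-replayed certificate and the window.

HONEST FRAMING: certified numerics for one explicit real integral, serving a HYPOTHETICAL filament-skeleton line on the NEGATIVE side of a
MODEL route; nothing here bears on Navier–Stokes regularity or blow-up.
-/

set_option linter.dupNamespace false

noncomputable section

namespace Summit.NavierStokesRegularity.NavierStokesRegularity.Theorems.AnalyticStripLiaSymbol

namespace Series

open Real Set MeasureTheory Filter Topology Finset
open Literature.NumberTheory.Sieve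

/-! ## §1  Casts of the partial sums -/

/-- `expT n y` is the real Taylor partial sum. -/
theorem expT_cast (n : ℕ) (y : ℚ) :
    ((expT n y : ℚ) : ℝ) = ∑ k ∈ range n, (-(y:ℝ)) ^ k / (k.factorial : ℝ) := by
  induction n with
  | zero => simp [expT]
  | succ n ih => rw [expT, sum_range_succ]; push_cast; rw [ih]

/-- `einT n x` is the real `Ein` partial sum. -/
theorem einT_cast (n : ℕ) (x : ℚ) :
    ((einT n x : ℚ) : ℝ) = ∑ k ∈ range n, (-1 : ℝ) ^ k * (x:ℝ) ^ (k + 1) / (((k + 1 : ℕ) : ℝ) * ((k + 1).factorial : ℝ)) := by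
  induction n with
  | zero => simp [einT]
  | succ n ih => rw [einT, sum_range_succ]; push_cast; rw [ih]; push_cast; rfl

/-- `logS n x` is the real logarithmic partial sum. -/
theorem logS_cast (n : ℕ) (x : ℚ) :
    ((logS n x : ℚ) : ℝ) = ∑ i ∈ range n, (x:ℝ) ^ (i + 1) / ((i:ℝ) + 1) := by
  induction n with
  | zero => simp [logS]
  | succ n ih => rw [logS, sum_range_succ]; push_cast; rw [ih]

/-! ## §2  Elementary enclosures -/

/-- `expLo y ≤ e^{−y} ≤ expHi y` (`y ≥ 0`; exact Taylor partial sums, 20/21 terms — no rounding, unlike `Numerics.expNegLo/Hi`). -/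
theorem exp_encl {y : ℚ} (hy : 0 ≤ y) :
    ((expLo y : ℚ) : ℝ) ≤ Real.exp (-(y:ℝ)) ∧ Real.exp (-(y:ℝ)) ≤ ((expHi y : ℚ) : ℝ) := by
  have hy' : (0:ℝ) ≤ y := by exact_mod_cast hy
  have h1 := taylor_even_le_exp_neg 10 hy'
  have h2 := exp_neg_le_taylor_odd 10 hy'
  rw [expLo, expHi, expT_cast, expT_cast]; exact ⟨h1, h2⟩

/-- `einLo x ≤ Ein x` (`x ≥ 0`). -/
theorem einLo_le {x : ℚ} (hx : 0 ≤ x) : ((einLo x : ℚ) : ℝ) ≤ ein (x:ℝ) := by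
  have hx' : (0:ℝ) ≤ x := by exact_mod_cast hx
  have h := einTaylor_even_le 12 hx'
  rw [einLo, einT_cast]; exact h

/-- `Ein x ≤ einHi x` (`x ≥ 0`). -/
theorem le_einHi {x : ℚ} (hx : 0 ≤ x) : ein (x:ℝ) ≤ ((einHi x : ℚ) : ℝ) := by
  have hx' : (0:ℝ) ≤ x := by exact_mod_cast hx
  have h := ein_le_einTaylor_odd 12 hx'
  rw [einHi, einT_cast]; exact h

/-- `γ ∈ [gLo, gHi]`. -/
theorem gamma_encl : ((gLo : ℚ) : ℝ) ≤ Real.eulerMascheroniConstant ∧ Real.eulerMascheroniConstant ≤ ((gHi : ℚ) : ℝ) := by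
  have h := eulerMascheroni_bounds
  rw [gLo, gHi]; push_cast
  constructor <;> linarith [h.1, h.2]

/-- `log 2 ∈ [l2Lo, l2Hi]`. -/
theorem log_two_encl : ((l2Lo : ℚ) : ℝ) ≤ Real.log 2 ∧ Real.log 2 ≤ ((l2Hi : ℚ) : ℝ) := by
  have h1 := Real.log_two_gt_d9
  have h2 := Real.log_two_lt_d9
  rw [l2Lo, l2Hi]; push_cast
  constructor <;> linarith

/-- The node factorisation: `log p = k·log 2 + log r`, `r = redArg p k > 0`. -/
theorem log_node (p : ℚ) (k : ℤ) (hp : 0 < p) :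
    Real.log (p:ℝ) = (k:ℝ) * Real.log 2 + Real.log ((redArg p k : ℚ) : ℝ) ∧ 0 < redArg p k := by
  unfold redArg
  split_ifs with hk
  · have hr : 0 < p / 2 ^ k.toNat := by positivity
    refine ⟨?_, hr⟩
    have hkk : ((k.toNat : ℕ) : ℝ) = (k:ℝ) := by exact_mod_cast Int.toNat_of_nonneg hk
    push_cast
    rw [Real.log_div (by exact_mod_cast hp.ne') (by positivity), Real.log_pow, hkk]
    ring
  · rw [not_le] at hk
    have hr : 0 < p * 2 ^ (-k).toNat := by positivity
    refine ⟨?_, hr⟩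
    have hkk : (((-k).toNat : ℕ) : ℝ) = -(k:ℝ) := by exact_mod_cast Int.toNat_of_nonneg (by omega : 0 ≤ -k)
    push_cast
    rw [Real.log_mul (by exact_mod_cast hp.ne') (by positivity), Real.log_pow, hkk]
    ring

/-- **`logLo p k ≤ log p ≤ logHi p k`** for an admissible node (`0 < p`, `|1 − r| ≤ 1/2`). -/
theorem log_encl (p : ℚ) (k : ℤ) (hp : 0 < p) (hok : logOK p k = true) :
    ((logLo p k : ℚ) : ℝ) ≤ Real.log (p:ℝ) ∧ Real.log (p:ℝ) ≤ ((logHi p k : ℚ) : ℝ) := by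
  obtain ⟨hlog, hr⟩ := log_node p k hp
  simp only [logOK, decide_eq_true_eq] at hok
  set r : ℚ := redArg p k with hrdef
  set x : ℝ := 1 - (r:ℝ) with hxdef
  have hxabs : |x| ≤ 1 / 2 := by
    have : ((|1 - r| : ℚ) : ℝ) ≤ (1/2 : ℚ) := by exact_mod_cast hok
    push_cast at this; exact this
  have hx1 : |x| < 1 := lt_of_le_of_lt hxabs (by norm_num)
  have hser := Real.abs_log_sub_add_sum_range_le hx1 36
  have hrx : (r:ℝ) = 1 - x := by rw [hxdef]; ring
  rw [hrx] at hlog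
  have hS : ((logS 36 (1 - r) : ℚ) : ℝ) = ∑ i ∈ range 36, x ^ (i + 1) / ((i:ℝ) + 1) := by
    rw [logS_cast]; push_cast; rw [hxdef]
  have hE : ((logErr p k : ℚ) : ℝ) = |x| ^ 37 / (1 - |x|) := by
    rw [logErr, ← hrdef]; push_cast; rw [hxdef]
  rw [abs_le] at hser
  obtain ⟨hl2, hu2⟩ := log_two_encl
  unfold logLo logHi
  rw [← hrdef]
  split_ifs with hk
  · have hk' : (0:ℝ) ≤ k := by exact_mod_cast hk
    have h3 : (k:ℝ) * ((l2Lo:ℚ):ℝ) ≤ (k:ℝ) * Real.log 2 := mul_le_mul_of_nonneg_left hl2 hk'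
    have h4 : (k:ℝ) * Real.log 2 ≤ (k:ℝ) * ((l2Hi:ℚ):ℝ) := mul_le_mul_of_nonneg_left hu2 hk'
    push_cast
    rw [hS, hE] at *
    constructor <;> linarith
  · rw [not_le] at hk
    have hk' : (k:ℝ) ≤ 0 := by exact_mod_cast hk.le
    have h3 : (k:ℝ) * ((l2Hi:ℚ):ℝ) ≤ (k:ℝ) * Real.log 2 := mul_le_mul_of_nonpos_left hu2 hk'
    have h4 : (k:ℝ) * Real.log 2 ≤ (k:ℝ) * ((l2Lo:ℚ):ℝ) := mul_le_mul_of_nonpos_left hl2 hk'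
    push_cast
    rw [hS, hE] at *
    constructor <;> linarith

/-- **`a0Lo ≤ α₀(p) ≤ a0Hi`** (`α₀(p) = E₁(p) = Ein p − γ − log p`, brick 3). -/
theorem a0_encl (p : ℚ) (k : ℤ) (hp : 0 < p) (hok : logOK p k = true) :
    ((a0Lo p k : ℚ) : ℝ) ≤ (∫ t in Ioc (0:ℝ) 1, Real.exp (-((p:ℝ) / t)) * t ^ 0 / t) ∧
      (∫ t in Ioc (0:ℝ) 1, Real.exp (-((p:ℝ) / t)) * t ^ 0 / t) ≤ ((a0Hi p k : ℚ) : ℝ) := by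
  have hp' : (0:ℝ) < p := by exact_mod_cast hp
  rw [alpha_zero hp']
  obtain ⟨hl, hu⟩ := log_encl p k hp hok
  obtain ⟨hg1, hg2⟩ := gamma_encl
  have he1 := einLo_le hp.le
  have he2 := le_einHi hp.le
  unfold a0Lo a0Hi
  push_cast
  constructor <;> linarith

/-- **Soundness of `alphaB`**: `(alphaB p k j).1 ≤ α_j(p) ≤ (alphaB p k j).2` for every `j`. -/
theorem alphaB_encl (p : ℚ) (k : ℤ) (hp : 0 < p) (hok : logOK p k = true) : ∀ j : ℕ,
    (((alphaB p k j).1 : ℚ) : ℝ) ≤ (∫ t in Ioc (0:ℝ) 1, Real.exp (-((p:ℝ) / t)) * t ^ j / t) ∧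
      (∫ t in Ioc (0:ℝ) 1, Real.exp (-((p:ℝ) / t)) * t ^ j / t) ≤ (((alphaB p k j).2 : ℚ) : ℝ) := by
  have hp' : (0:ℝ) < p := by exact_mod_cast hp
  intro j
  induction j with
  | zero => exact a0_encl p k hp hok
  | succ j ih =>
    have hrec := alpha_succ j hp'
    have he1 := (exp_encl hp.le).1
    have he2 := (exp_encl hp.le).2
    set A := ∫ t in Ioc (0:ℝ) 1, Real.exp (-((p:ℝ) / t)) * t ^ j / t with hA
    set B := ∫ t in Ioc (0:ℝ) 1, Real.exp (-((p:ℝ) / t)) * t ^ (j + 1) / t with hB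
    have hj : (0:ℝ) < (j:ℝ) + 1 := by positivity
    have hBeq : B = (Real.exp (-(p:ℝ)) - (p:ℝ) * A) / ((j:ℝ) + 1) := by
      field_simp; linarith
    obtain ⟨ih1, ih2⟩ := ih
    have hpA1 : (p:ℝ) * (((alphaB p k j).1 : ℚ) : ℝ) ≤ (p:ℝ) * A := mul_le_mul_of_nonneg_left ih1 hp'.le
    have hpA2 : (p:ℝ) * A ≤ (p:ℝ) * (((alphaB p k j).2 : ℚ) : ℝ) := mul_le_mul_of_nonneg_left ih2 hp'.le
    simp only [alphaB]
    push_cast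
    rw [hBeq]
    constructor
    · rw [div_le_div_iff_of_pos_right hj]; linarith
    · rw [div_le_div_iff_of_pos_right hj]; linarith

/-- **Soundness of `betaB`**: `(betaB m).1 ≤ β_m ≤ (betaB m).2` for every `m`. -/
theorem betaB_encl : ∀ m : ℕ,
    (((betaB m).1 : ℚ) : ℝ) ≤ (∫ t in Ioi (1:ℝ), Real.exp (-t) * t ^ (-(m:ℤ))) ∧
      (∫ t in Ioi (1:ℝ), Real.exp (-t) * t ^ (-(m:ℤ))) ≤ (((betaB m).2 : ℚ) : ℝ) := by
  have he1 : ((expLo 1 : ℚ) : ℝ) ≤ Real.exp (-1) := by simpa using (exp_encl (zero_le_one)).1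
  have he2 : Real.exp (-1) ≤ ((expHi 1 : ℚ) : ℝ) := by simpa using (exp_encl (zero_le_one)).2
  have h0 : (((betaB 0).1 : ℚ) : ℝ) ≤ (∫ t in Ioi (1:ℝ), Real.exp (-t) * t ^ (-((0:ℕ):ℤ))) ∧
      (∫ t in Ioi (1:ℝ), Real.exp (-t) * t ^ (-((0:ℕ):ℤ))) ≤ (((betaB 0).2 : ℚ) : ℝ) := by
    rw [beta_zero]; simp only [betaB]; exact ⟨he1, he2⟩
  have h1 : (((betaB 1).1 : ℚ) : ℝ) ≤ (∫ t in Ioi (1:ℝ), Real.exp (-t) * t ^ (-((1:ℕ):ℤ))) ∧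
      (∫ t in Ioi (1:ℝ), Real.exp (-t) * t ^ (-((1:ℕ):ℤ))) ≤ (((betaB 1).2 : ℚ) : ℝ) := by
    rw [beta_one]
    have hE : expIntegralE1 1 = ein 1 - Real.eulerMascheroniConstant := by
      have := ein_eq_add one_pos; rw [Real.log_one] at this; linarith
    rw [hE]
    obtain ⟨hg1, hg2⟩ := gamma_encl
    have hi1 : ((einLo 1 : ℚ) : ℝ) ≤ ein 1 := by simpa using einLo_le (zero_le_one)
    have hi2 : ein 1 ≤ ((einHi 1 : ℚ) : ℝ) := by simpa using le_einHi (zero_le_one)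
    simp only [betaB]; push_cast
    constructor <;> linarith
  -- steps `m + 1 → m + 2` from the recurrence `β_{m+1} + (m+1) β_{m+2} = e^{−1}`
  have hstep : ∀ m : ℕ,
      ((((betaB (m + 1)).1 : ℚ) : ℝ) ≤ (∫ t in Ioi (1:ℝ), Real.exp (-t) * t ^ (-((m + 1 : ℕ):ℤ))) ∧
        (∫ t in Ioi (1:ℝ), Real.exp (-t) * t ^ (-((m + 1 : ℕ):ℤ))) ≤ (((betaB (m + 1)).2 : ℚ) : ℝ)) →
      ((((betaB (m + 2)).1 : ℚ) : ℝ) ≤ (∫ t in Ioi (1:ℝ), Real.exp (-t) * t ^ (-((m + 2 : ℕ):ℤ))) ∧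
        (∫ t in Ioi (1:ℝ), Real.exp (-t) * t ^ (-((m + 2 : ℕ):ℤ))) ≤ (((betaB (m + 2)).2 : ℚ) : ℝ)) := by
    intro m ih
    have hrec := beta_succ (m + 1)
    set A := ∫ t in Ioi (1:ℝ), Real.exp (-t) * t ^ (-((m + 1 : ℕ):ℤ)) with hA
    set B := ∫ t in Ioi (1:ℝ), Real.exp (-t) * t ^ (-((m + 1 + 1 : ℕ):ℤ)) with hB
    have hm : (0:ℝ) < ((m + 1 : ℕ) : ℝ) := by positivity
    have hBeq : B = (Real.exp (-1) - A) / ((m + 1 : ℕ) : ℝ) := by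
      field_simp; linarith
    rw [hBeq]
    obtain ⟨ih1, ih2⟩ := ih
    simp only [betaB]
    push_cast
    push_cast at hm
    constructor
    · rw [div_le_div_iff_of_pos_right hm]; linarith
    · rw [div_le_div_iff_of_pos_right hm]; linarith
  have hall : ∀ m : ℕ, (((betaB (m + 1)).1 : ℚ) : ℝ) ≤ (∫ t in Ioi (1:ℝ), Real.exp (-t) * t ^ (-((m + 1 : ℕ):ℤ))) ∧
      (∫ t in Ioi (1:ℝ), Real.exp (-t) * t ^ (-((m + 1 : ℕ):ℤ))) ≤ (((betaB (m + 1)).2 : ℚ) : ℝ) := by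
    intro m
    induction m with
    | zero => exact h1
    | succ m ih => exact hstep m ih
  intro m
  cases m with
  | zero => exact h0
  | succ m => exact hall m

end Series

end Summit.NavierStokesRegularity.NavierStokesRegularity.Theorems.AnalyticStripLiaSymbol

end
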